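import Mathlib
import HarnessLib
import Summits.HubbardSuperconductivity.HubbardSuperconductivity.Theorems.KLProgrammeC4aAbsBubbleNonCooper

/-!
# Route `KLProgramme` — crux C4a, S3 brick (B4)/(B5) «(B4)-DIRECT-PACK», part 6: THE TUBE-ANGLE LAYER — the absolute co-moving bubble of the pp partner band is
# `n`-FREE in `L¹(dϑ)` UNIFORMLY in the level offset `ρ` and the base angle `θ`, with FrameOK-only constants and NO located datum

Cell `gate-hubbard-kl`, seat hubbard-kl-k3c3-p3 (g27; row «implicit-function / monotonicity route for μ(n)»).  Located brick for the (C)-closer lane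
hubbard-kl-c4a-1 (stub (C) `stub_twoLeg_curvature` of `KLRegimeEngineV17F2`, stmt-HubbardSuperconductivity-20437), C4A-PLAN §24.4 «EXPECTED RESULT:
`sup_{|ρ|<r} ∫dϑ |𝐁(ρ,ϑ,θ)|` `n`-FREE» at the value level (B4-DIRECT-COUNT §2: the co-moving jets are `≤ C_k(1+|ρ|/Λ)^k ×` this), memo B4-DIRECT-PACK.md §6.

For the level × loop integral `F(ϑ) = ∫_{lo..hi} w(e)·(∫_{[a,b]} dx/max(t e, |e_K(S_{ρϑθ} − Φ(e,x+θ))|)) de` of the absolute bubble at the configuration `(ρ,ϑ,θ)`: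
every `ϑ ≢ π` has chord `s = ‖S‖ ≥ (2u_min/π)‖ϑ−π‖_𝕋 > 0` (part 2); if `s ≤ s_C` the Cooper class (part 3 §3, keyed on the chord) gives
`F ≤ K_C + P·log⁺(hi/(ĉ₀s/2)) ≤ K_C + P·log⁺(M/‖ϑ−π‖_𝕋)` (`M = πhi/(ĉ₀u_min)`); if `s > s_C ≥ s₀ = msD₁τ(d₁,κ) + κ/(Dt−2A)` the configuration is non-Cooper relative
to every sheet (`m ≠ 0` by the umklapp margin `3/5`) and part 5 gives `F ≤ K_T`.  Hence `F(ϑ) ≤ K_T + K_C + P·log⁺(M/|ϑ − π|)` on `[0,2π] ∖ {π}` and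
`…C4aAbsBubbleLevelLoop.intervalIntegral_cooper_window_le` integrates the Cooper logarithm:
**`intervalIntegral_angle_absBubble_partnerBand_le`**: `∫_{0}^{2π} F(ϑ) dϑ ≤ 2π·(K_T + K_C + P·(1 + log⁺(M/π)))` for every `|ρ| < r` and every `θ` — the constants
depend only on clause (i) of `FrameOK` (through `K₁,K₂,K₃, msD_j, Dt−2A, u_min, w, Kc`), the thresholds `(ĉ₀,ĉ₁,s_C | d₁,κ)`, the cell counts, `hi` and `W`;
NOT on `lo` (the infrared end `Λ_n/2` of the band window), `ρ`, `θ`.  This is Salmhofer's one-loop volume bound «the only place where the bubble can diverge is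
q = 0, and there only logarithmically» (Cor. 4.11) in the co-moving level coordinates of C4A-PLAN §24.4, for the lattice band with a `FrameOK` frame.
Nothing asserts (C), K3 or superconductivity.  References: Salmhofer 1999 §4.5.3 Lemma 4.10 / Cor. 4.11 [cite: Salmhofer1999]; FST II CPAM 51 (1998) §3
[cite: FeldmanSalmhoferTrubowitz1998]; BGM 2006 §2.4, App. A2 [cite: BenfattoGiulianiMastropietro2006].
-/

noncomputable section

namespace Summit.HubbardSuperconductivity.HubbardSuperconductivity.Theorems.C4a

set_option linter.dupNamespace false -- summit = problem name (single-conjunct summit), D-0017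

open Real Set MeasureTheory
open Literature.MathematicalPhysics.QuantumLattice Literature.MathematicalPhysics.QuantumLattice.BandSectorCounting
open Literature.MathematicalPhysics.QuantumLattice.FermiRG
open Summit.HubbardSuperconductivity.HubbardSuperconductivity.Theorems.KLRegimeSplit
open Summit.HubbardSuperconductivity.HubbardSuperconductivity.Theorems.DispersionFlow
open Summit.HubbardSuperconductivity.HubbardSuperconductivity.Theorems.PerturbedFermiCurve

/-- `‖x‖_𝕋 = |x|` for `|x| ≤ π`. [folklore] -/
theorem torusDist_eq_abs_of_abs_le_pi {x : ℝ} (hx : |x| ≤ π) : torusDist x = |x| := by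
  rw [FermiRG.torusDist, AddCircle.norm_coe_eq_abs_iff (2 * π) Real.two_pi_pos.ne', abs_of_pos Real.two_pi_pos]
  linarith

section Sizes

variable {K : TrigPolyC4v} {A : ℝ} (hA : ∀ p : Momentum, ∀ j ≤ 2, ‖iteratedFDeriv ℝ j (frameShift K) p‖ ≤ A) (hA20 : A ≤ 1 / 20)
  (hd : klCurveD ≤ (bandBounds (show (-4 : ℝ) < -1.1 by norm_num) (show (-1.1 : ℝ) ≤ -0.1 by norm_num)
    (show (-0.1 : ℝ) < 0 by norm_num)).Dtmin - 2 * A)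
  {μ r : ℝ} (hr : 0 < r) (hlo : (-1.1 : ℝ) < μ - r - A) (hhi : μ + r + A < -0.1)
  {A₃ A₄ : ℝ} (hA₃ : ∀ p : Momentum, ‖iteratedFDeriv ℝ 3 (frameShift K) p‖ ≤ A₃)
  (hA₄ : ∀ p : Momentum, ‖iteratedFDeriv ℝ 4 (frameShift K) p‖ ≤ A₄)
  {K₁ K₂ K₃ : ℝ} (hK₁ : ∀ p : Momentum, ‖fderiv ℝ (frameLevel μ K) p‖ ≤ K₁) (hK₂ : ∀ p : Momentum, ‖iteratedFDeriv ℝ 2 (frameLevel μ K) p‖ ≤ K₂)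
  (hK₃ : ∀ p : Momentum, ‖iteratedFDeriv ℝ 3 (frameLevel μ K) p‖ ≤ K₃)
include hA hA20 hd hr hlo hhi hA₃ hA₄ hK₁ hK₂ hK₃

/-- **THE ABSOLUTE CO-MOVING BUBBLE IS `n`-FREE IN `L¹(dϑ)`, UNIFORMLY IN `(ρ, θ)`** (value level of (B4)/(B5); no located datum).  Hypotheses: clause (i) of
`FrameOK` in the Sizes binder shape (`GeomConstants (frameLevel μ K) Kc r₀ g₀ w`, `K₁ > 0`, `K₂ > 0`); a level offset `|ρ| < r` and base angle `θ`; loop piece `[a,b]`;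
levels `e ∈ [lo,hi]`, `0 < lo ≤ hi < r₀`; COOPER thresholds `ĉ₀, ĉ₁ > 0`, window radius `s_C` with `X(ĉ₀,ĉ₁) < 1`, `s_C·X + 2hi/(Dt−2A) + s_C < min(3/5, 2u_min)`,
`hi + ĉ₀s_C < r`, cells `(b−a)·4K₂msD₁ ≤ N_C·ĉ₀`; TRANSVERSAL/FOLD thresholds `d₁, κ > 0` with `s₀ = msD₁τ(d₁,κ) + κ/(Dt−2A) ≤ min(s_C, 3/5)`, `hi + κ < r`,
the smallness `hsmall` of part 5, cells `(b−a)·4K₁msD₁ ≤ N_Tκ`, `(b−a)·4(K₂msD₁² + K₁msD₂) ≤ N_T d₁`; envelope floors `t e ≥ e`, weight `0 ≤ w ≤ W`.  THEN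
`∫_{π−π}^{π+π} F(ϑ) dϑ ≤ 2π·(K_T + K_C + W(b−a)·(1 + log⁺((πhi/(ĉ₀u_min))/π)))` with `K_T`, `K_C` the part-5 / part-3 constants — independent of `lo`, `ρ`, `θ`.
[cite: Salmhofer1999, §4.5.3 Cor. 4.11; FeldmanSalmhoferTrubowitz1998, §3 Thm 3.5] -/
theorem intervalIntegral_angle_absBubble_partnerBand_le {Kc r₀ g₀ w : ℝ} (hG : GeomConstants (frameLevel μ K) Kc r₀ g₀ w) (hK₁0 : 0 < K₁) (hK₂0 : 0 < K₂)
    {ρ θ a b lo hi W c₀ c₁ sC d₁ κ : ℝ} {t wt : ℝ → ℝ} {NC NT : ℕ} (hρ : |ρ| < r)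
    (hab : a ≤ b) (hlo0 : 0 < lo) (hlohi : lo ≤ hi) (hhir₀ : hi < r₀)
    (hc₀ : 0 < c₀) (hc₁ : 0 < c₁)
    (hX : ((msD A₃ A₄ 1 *
            ((π / 2 * c₁ /
                  (((bandBounds (show (-4 : ℝ) < -1.1 by norm_num) (show (-1.1 : ℝ) ≤ -0.1 by norm_num) (show (-0.1 : ℝ) < 0 by norm_num)).Dtmin -
                      2 * A) *
                    (bandBounds (show (-4 : ℝ) < -1.1 by norm_num) (show (-1.1 : ℝ) ≤ -0.1 by norm_num) (show (-0.1 : ℝ) < 0 by norm_num)).umin) +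
                π * Kc * c₀ / ((bandBounds (show (-4 : ℝ) < -1.1 by norm_num) (show (-1.1 : ℝ) ≤ -0.1 by norm_num) (show (-0.1 : ℝ) < 0 by norm_num)).Dtmin - 2 * A) ^ 2) /
              ((bandBounds (show (-4 : ℝ) < -1.1 by norm_num) (show (-1.1 : ℝ) ≤ -0.1 by norm_num) (show (-0.1 : ℝ) < 0 by norm_num)).umin * w /
                (4 + 2 * A)))) +
          c₀ / ((bandBounds (show (-4 : ℝ) < -1.1 by norm_num) (show (-1.1 : ℝ) ≤ -0.1 by norm_num) (show (-0.1 : ℝ) < 0 by norm_num)).Dtmin - 2 * A)) < 1)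
    (hwinC : sC * ((msD A₃ A₄ 1 *
            ((π / 2 * c₁ /
                  (((bandBounds (show (-4 : ℝ) < -1.1 by norm_num) (show (-1.1 : ℝ) ≤ -0.1 by norm_num) (show (-0.1 : ℝ) < 0 by norm_num)).Dtmin -
                      2 * A) *
                    (bandBounds (show (-4 : ℝ) < -1.1 by norm_num) (show (-1.1 : ℝ) ≤ -0.1 by norm_num) (show (-0.1 : ℝ) < 0 by norm_num)).umin) +
                π * Kc * c₀ / ((bandBounds (show (-4 : ℝ) < -1.1 by norm_num) (show (-1.1 : ℝ) ≤ -0.1 by norm_num) (show (-0.1 : ℝ) < 0 by norm_num)).Dtmin - 2 * A) ^ 2) /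
              ((bandBounds (show (-4 : ℝ) < -1.1 by norm_num) (show (-1.1 : ℝ) ≤ -0.1 by norm_num) (show (-0.1 : ℝ) < 0 by norm_num)).umin * w /
                (4 + 2 * A)))) +
          c₀ / ((bandBounds (show (-4 : ℝ) < -1.1 by norm_num) (show (-1.1 : ℝ) ≤ -0.1 by norm_num) (show (-0.1 : ℝ) < 0 by norm_num)).Dtmin - 2 * A)) +
          2 * hi / ((bandBounds (show (-4 : ℝ) < -1.1 by norm_num) (show (-1.1 : ℝ) ≤ -0.1 by norm_num) (show (-0.1 : ℝ) < 0 by norm_num)).Dtmin - 2 * A) + sC < 3 / 5)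
    (hwinC' : sC * ((msD A₃ A₄ 1 *
            ((π / 2 * c₁ /
                  (((bandBounds (show (-4 : ℝ) < -1.1 by norm_num) (show (-1.1 : ℝ) ≤ -0.1 by norm_num) (show (-0.1 : ℝ) < 0 by norm_num)).Dtmin -
                      2 * A) *
                    (bandBounds (show (-4 : ℝ) < -1.1 by norm_num) (show (-1.1 : ℝ) ≤ -0.1 by norm_num) (show (-0.1 : ℝ) < 0 by norm_num)).umin) +
                π * Kc * c₀ / ((bandBounds (show (-4 : ℝ) < -1.1 by norm_num) (show (-1.1 : ℝ) ≤ -0.1 by norm_num) (show (-0.1 : ℝ) < 0 by norm_num)).Dtmin - 2 * A) ^ 2) /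
              ((bandBounds (show (-4 : ℝ) < -1.1 by norm_num) (show (-1.1 : ℝ) ≤ -0.1 by norm_num) (show (-0.1 : ℝ) < 0 by norm_num)).umin * w /
                (4 + 2 * A)))) +
          c₀ / ((bandBounds (show (-4 : ℝ) < -1.1 by norm_num) (show (-1.1 : ℝ) ≤ -0.1 by norm_num) (show (-0.1 : ℝ) < 0 by norm_num)).Dtmin - 2 * A)) +
          2 * hi / ((bandBounds (show (-4 : ℝ) < -1.1 by norm_num) (show (-1.1 : ℝ) ≤ -0.1 by norm_num) (show (-0.1 : ℝ) < 0 by norm_num)).Dtmin - 2 * A) + sC <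
        2 * (bandBounds (show (-4 : ℝ) < -1.1 by norm_num) (show (-1.1 : ℝ) ≤ -0.1 by norm_num) (show (-0.1 : ℝ) < 0 by norm_num)).umin)
    (hhirC : hi + c₀ * sC < r) (hNC : (b - a) * (4 * (K₂ * msD A₃ A₄ 1)) ≤ NC * c₀)
    (hd₁ : 0 < d₁) (hκ : 0 < κ)
    (hs₀ : ((msD A₃ A₄ 1 *
            ((π / 2 * d₁ /
                  (((bandBounds (show (-4 : ℝ) < -1.1 by norm_num) (show (-1.1 : ℝ) ≤ -0.1 by norm_num) (show (-0.1 : ℝ) < 0 by norm_num)).Dtmin -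
                      2 * A) *
                    (bandBounds (show (-4 : ℝ) < -1.1 by norm_num) (show (-1.1 : ℝ) ≤ -0.1 by norm_num) (show (-0.1 : ℝ) < 0 by norm_num)).umin) +
                π * Kc * κ / ((bandBounds (show (-4 : ℝ) < -1.1 by norm_num) (show (-1.1 : ℝ) ≤ -0.1 by norm_num) (show (-0.1 : ℝ) < 0 by norm_num)).Dtmin - 2 * A) ^ 2) /
              ((bandBounds (show (-4 : ℝ) < -1.1 by norm_num) (show (-1.1 : ℝ) ≤ -0.1 by norm_num) (show (-0.1 : ℝ) < 0 by norm_num)).umin * w /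
                (4 + 2 * A)))) +
          κ / ((bandBounds (show (-4 : ℝ) < -1.1 by norm_num) (show (-1.1 : ℝ) ≤ -0.1 by norm_num) (show (-0.1 : ℝ) < 0 by norm_num)).Dtmin - 2 * A)) ≤ sC)
    (hs₀' : ((msD A₃ A₄ 1 *
            ((π / 2 * d₁ /
                  (((bandBounds (show (-4 : ℝ) < -1.1 by norm_num) (show (-1.1 : ℝ) ≤ -0.1 by norm_num) (show (-0.1 : ℝ) < 0 by norm_num)).Dtmin -
                      2 * A) *
                    (bandBounds (show (-4 : ℝ) < -1.1 by norm_num) (show (-1.1 : ℝ) ≤ -0.1 by norm_num) (show (-0.1 : ℝ) < 0 by norm_num)).umin) +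
                π * Kc * κ / ((bandBounds (show (-4 : ℝ) < -1.1 by norm_num) (show (-1.1 : ℝ) ≤ -0.1 by norm_num) (show (-0.1 : ℝ) < 0 by norm_num)).Dtmin - 2 * A) ^ 2) /
              ((bandBounds (show (-4 : ℝ) < -1.1 by norm_num) (show (-1.1 : ℝ) ≤ -0.1 by norm_num) (show (-0.1 : ℝ) < 0 by norm_num)).umin * w /
                (4 + 2 * A)))) +
          κ / ((bandBounds (show (-4 : ℝ) < -1.1 by norm_num) (show (-1.1 : ℝ) ≤ -0.1 by norm_num) (show (-0.1 : ℝ) < 0 by norm_num)).Dtmin - 2 * A)) ≤ 3 / 5)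
    (hhirT : hi + κ < r)
    (hsmall :
        K₃ * ((msD A₃ A₄ 1 *
            ((π / 2 * d₁ /
                  (((bandBounds (show (-4 : ℝ) < -1.1 by norm_num) (show (-1.1 : ℝ) ≤ -0.1 by norm_num) (show (-0.1 : ℝ) < 0 by norm_num)).Dtmin -
                      2 * A) *
                    (bandBounds (show (-4 : ℝ) < -1.1 by norm_num) (show (-1.1 : ℝ) ≤ -0.1 by norm_num) (show (-0.1 : ℝ) < 0 by norm_num)).umin) +
                π * Kc * κ / ((bandBounds (show (-4 : ℝ) < -1.1 by norm_num) (show (-1.1 : ℝ) ≤ -0.1 by norm_num) (show (-0.1 : ℝ) < 0 by norm_num)).Dtmin - 2 * A) ^ 2) /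
              ((bandBounds (show (-4 : ℝ) < -1.1 by norm_num) (show (-1.1 : ℝ) ≤ -0.1 by norm_num) (show (-0.1 : ℝ) < 0 by norm_num)).umin * w /
                (4 + 2 * A)))) +
          (2 * hi + κ) / ((bandBounds (show (-4 : ℝ) < -1.1 by norm_num) (show (-1.1 : ℝ) ≤ -0.1 by norm_num) (show (-0.1 : ℝ) < 0 by norm_num)).Dtmin - 2 * A) +
              hi / ((bandBounds (show (-4 : ℝ) < -1.1 by norm_num) (show (-1.1 : ℝ) ≤ -0.1 by norm_num) (show (-0.1 : ℝ) < 0 by norm_num)).Dtmin - 2 * A)) *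
            msD A₃ A₄ 1 ^ 2 +
          K₂ * (radialRowOneConst A ((bandBounds (show (-4 : ℝ) < -1.1 by norm_num) (show (-1.1 : ℝ) ≤ -0.1 by norm_num) (show (-0.1 : ℝ) < 0 by norm_num)).Dtmin -
                2 * A) * hi) * (msD A₃ A₄ 1 + msD A₃ A₄ 1) +
          K₂ * ((msD A₃ A₄ 1 *
            ((π / 2 * d₁ /
                  (((bandBounds (show (-4 : ℝ) < -1.1 by norm_num) (show (-1.1 : ℝ) ≤ -0.1 by norm_num) (show (-0.1 : ℝ) < 0 by norm_num)).Dtmin -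
                      2 * A) *
                    (bandBounds (show (-4 : ℝ) < -1.1 by norm_num) (show (-1.1 : ℝ) ≤ -0.1 by norm_num) (show (-0.1 : ℝ) < 0 by norm_num)).umin) +
                π * Kc * κ / ((bandBounds (show (-4 : ℝ) < -1.1 by norm_num) (show (-1.1 : ℝ) ≤ -0.1 by norm_num) (show (-0.1 : ℝ) < 0 by norm_num)).Dtmin - 2 * A) ^ 2) /
              ((bandBounds (show (-4 : ℝ) < -1.1 by norm_num) (show (-1.1 : ℝ) ≤ -0.1 by norm_num) (show (-0.1 : ℝ) < 0 by norm_num)).umin * w /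
                (4 + 2 * A)))) +
          (2 * hi + κ) / ((bandBounds (show (-4 : ℝ) < -1.1 by norm_num) (show (-1.1 : ℝ) ≤ -0.1 by norm_num) (show (-0.1 : ℝ) < 0 by norm_num)).Dtmin - 2 * A) +
              hi / ((bandBounds (show (-4 : ℝ) < -1.1 by norm_num) (show (-1.1 : ℝ) ≤ -0.1 by norm_num) (show (-0.1 : ℝ) < 0 by norm_num)).Dtmin - 2 * A)) *
            msD A₃ A₄ 2 +
          K₁ * ((uRowTwoConst A A₃ ((bandBounds (show (-4 : ℝ) < -1.1 by norm_num) (show (-1.1 : ℝ) ≤ -0.1 by norm_num) (show (-0.1 : ℝ) < 0 by norm_num)).Dtmin -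
                  2 * A) +
                1 / ((bandBounds (show (-4 : ℝ) < -1.1 by norm_num) (show (-1.1 : ℝ) ≤ -0.1 by norm_num) (show (-0.1 : ℝ) < 0 by norm_num)).Dtmin - 2 * A) +
                2 * (radialRowOneConst A ((bandBounds (show (-4 : ℝ) < -1.1 by norm_num) (show (-1.1 : ℝ) ≤ -0.1 by norm_num) (show (-0.1 : ℝ) < 0 by norm_num)).Dtmin - 2 * A) -
                  1 / ((bandBounds (show (-4 : ℝ) < -1.1 by norm_num) (show (-1.1 : ℝ) ≤ -0.1 by norm_num) (show (-0.1 : ℝ) < 0 by norm_num)).Dtmin - 2 * A))) *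
              hi) ≤
        w * (bandBounds (show (-4 : ℝ) < -1.1 by norm_num) (show (-1.1 : ℝ) ≤ -0.1 by norm_num) (show (-0.1 : ℝ) < 0 by norm_num)).umin ^ 2)
    (hNT : (b - a) * (4 * (K₁ * msD A₃ A₄ 1)) ≤ NT * κ) (hNT' : (b - a) * (4 * (K₂ * msD A₃ A₄ 1 ^ 2 + K₁ * msD A₃ A₄ 2)) ≤ NT * d₁)
    (ht : ∀ e ∈ Icc lo hi, e ≤ t e) (hW : 0 ≤ W) (hw0 : ∀ e ∈ Icc lo hi, 0 ≤ wt e) (hw : ∀ e ∈ Icc lo hi, wt e ≤ W) :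
    ∫ ϑ in (π - π)..(π + π), (∫ e in lo..hi, wt e * ∫ x in Icc a b, (max (t e) |frameLevel μ K (pairSumPath μ K ρ ϑ θ 0 - levelPoint μ K e (x + θ))|)⁻¹) ≤
      2 * π * ((W * ((4 * (b - a) / κ + 2 * (NT * (4 / d₁))) * (κ / 2) +
          2 * (12 * NT / Real.sqrt (w * (bandBounds (show (-4 : ℝ) < -1.1 by norm_num) (show (-1.1 : ℝ) ≤ -0.1 by norm_num) (show (-0.1 : ℝ) < 0 by norm_num)).umin ^ 2)) * Real.sqrt (κ / 2) + (b - a) * log⁺ (hi / (κ / 2)))) + (W * (2 * (b - a) + 2 * (NC * c₀ / c₁))) +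
        (W * (b - a)) * (1 + log⁺ ((π * hi / (c₀ * (bandBounds (show (-4 : ℝ) < -1.1 by norm_num) (show (-1.1 : ℝ) ≤ -0.1 by norm_num) (show (-0.1 : ℝ) < 0 by norm_num)).umin)) / π))) := by
  have hM := msD_one_pos A₃ A₄
  have hM2 := msD_two_pos A₃ A₄
  have hupos := (bandBounds (show (-4 : ℝ) < -1.1 by norm_num) (show (-1.1 : ℝ) ≤ -0.1 by norm_num) (show (-0.1 : ℝ) < 0 by norm_num)).umin_pos
  have hwpos := hG.wmin_pos
  have hDt : 0 < (bandBounds (show (-4 : ℝ) < -1.1 by norm_num) (show (-1.1 : ℝ) ≤ -0.1 by norm_num) (show (-0.1 : ℝ) < 0 by norm_num)).Dtmin - 2 * A := by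
    have := klCurveD_pos; linarith
  have hA0 : 0 ≤ A := (norm_nonneg _).trans (hA 0 0 (by norm_num))
  have hKc : 0 ≤ Kc := le_trans (norm_nonneg _) (hG.norm_iteratedFDeriv_le (0 : Momentum) 0 (by norm_num))
  have hposlog : ∀ y : ℝ, 0 ≤ log⁺ y := fun y => Real.posLog_nonneg
  -- the two class constants are nonnegative
  have hKT0 : 0 ≤ (W * ((4 * (b - a) / κ + 2 * (NT * (4 / d₁))) * (κ / 2) +
          2 * (12 * NT / Real.sqrt (w * (bandBounds (show (-4 : ℝ) < -1.1 by norm_num) (show (-1.1 : ℝ) ≤ -0.1 by norm_num) (show (-0.1 : ℝ) < 0 by norm_num)).umin ^ 2)) * Real.sqrt (κ / 2) + (b - a) * log⁺ (hi / (κ / 2)))) := by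
    have := hposlog (hi / (κ / 2))
    positivity
  have hKC0 : 0 ≤ (W * (2 * (b - a) + 2 * (NC * c₀ / c₁))) := by positivity
  have hP0 : 0 ≤ (W * (b - a)) := mul_nonneg hW (by linarith)
  have hX0 : 0 ≤ ((msD A₃ A₄ 1 *
            ((π / 2 * c₁ /
                  (((bandBounds (show (-4 : ℝ) < -1.1 by norm_num) (show (-1.1 : ℝ) ≤ -0.1 by norm_num) (show (-0.1 : ℝ) < 0 by norm_num)).Dtmin -
                      2 * A) *
                    (bandBounds (show (-4 : ℝ) < -1.1 by norm_num) (show (-1.1 : ℝ) ≤ -0.1 by norm_num) (show (-0.1 : ℝ) < 0 by norm_num)).umin) +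
                π * Kc * c₀ / ((bandBounds (show (-4 : ℝ) < -1.1 by norm_num) (show (-1.1 : ℝ) ≤ -0.1 by norm_num) (show (-0.1 : ℝ) < 0 by norm_num)).Dtmin - 2 * A) ^ 2) /
              ((bandBounds (show (-4 : ℝ) < -1.1 by norm_num) (show (-1.1 : ℝ) ≤ -0.1 by norm_num) (show (-0.1 : ℝ) < 0 by norm_num)).umin * w /
                (4 + 2 * A)))) +
          c₀ / ((bandBounds (show (-4 : ℝ) < -1.1 by norm_num) (show (-1.1 : ℝ) ≤ -0.1 by norm_num) (show (-0.1 : ℝ) < 0 by norm_num)).Dtmin - 2 * A)) := by positivity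
  refine intervalIntegral_cooper_window_le (F := fun ϑ => (∫ e in lo..hi, wt e * ∫ x in Icc a b, (max (t e) |frameLevel μ K (pairSumPath μ K ρ ϑ θ 0 - levelPoint μ K e (x + θ))|)⁻¹)) Real.pi_pos (add_nonneg hKT0 hKC0) hP0 ?_ ?_
  · -- `F ≥ 0`
    intro ϑ _
    refine intervalIntegral.integral_nonneg hlohi fun e he => mul_nonneg (hw0 e he) ?_
    exact integral_inv_envelope_nonneg _ ((hlo0.trans_le he.1).trans_le (ht e he)) a b
  · -- the pointwise bound off the Cooper angle
    intro ϑ hϑ hne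
    have habsle : |ϑ - π| ≤ π := abs_le.2 ⟨by linarith [hϑ.1], by linarith [hϑ.2]⟩
    have hTd : torusDist (ϑ - π) = |ϑ - π| := torusDist_eq_abs_of_abs_le_pi habsle
    have hpos : 0 < |ϑ - π| := abs_pos.2 (sub_ne_zero.2 hne)
    have hTpos : 0 < torusDist (ϑ - π) := by rw [hTd]; exact hpos
    -- the chord is positive
    have hch := torusDist_sub_pi_le_norm_pairSum hA hr hlo hhi hρ ϑ θ
    have hs : 0 < ‖pairSumPath μ K ρ ϑ θ 0‖ := lt_of_lt_of_le (by positivity) hch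
    by_cases hsle : ‖pairSumPath μ K ρ ϑ θ 0‖ ≤ sC
    · -- COOPER CLASS (part 3 §3), then the log of the chord is a log of the tube angle (part 3 §4)
      have hwin : ‖pairSumPath μ K ρ ϑ θ 0‖ * ((msD A₃ A₄ 1 *
            ((π / 2 * c₁ /
                  (((bandBounds (show (-4 : ℝ) < -1.1 by norm_num) (show (-1.1 : ℝ) ≤ -0.1 by norm_num) (show (-0.1 : ℝ) < 0 by norm_num)).Dtmin -
                      2 * A) *
                    (bandBounds (show (-4 : ℝ) < -1.1 by norm_num) (show (-1.1 : ℝ) ≤ -0.1 by norm_num) (show (-0.1 : ℝ) < 0 by norm_num)).umin) +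
                π * Kc * c₀ / ((bandBounds (show (-4 : ℝ) < -1.1 by norm_num) (show (-1.1 : ℝ) ≤ -0.1 by norm_num) (show (-0.1 : ℝ) < 0 by norm_num)).Dtmin - 2 * A) ^ 2) /
              ((bandBounds (show (-4 : ℝ) < -1.1 by norm_num) (show (-1.1 : ℝ) ≤ -0.1 by norm_num) (show (-0.1 : ℝ) < 0 by norm_num)).umin * w /
                (4 + 2 * A)))) +
          c₀ / ((bandBounds (show (-4 : ℝ) < -1.1 by norm_num) (show (-1.1 : ℝ) ≤ -0.1 by norm_num) (show (-0.1 : ℝ) < 0 by norm_num)).Dtmin - 2 * A)) +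
          2 * hi / ((bandBounds (show (-4 : ℝ) < -1.1 by norm_num) (show (-1.1 : ℝ) ≤ -0.1 by norm_num) (show (-0.1 : ℝ) < 0 by norm_num)).Dtmin - 2 * A) + ‖pairSumPath μ K ρ ϑ θ 0‖ < 3 / 5 := by
        have h1 := mul_le_mul_of_nonneg_right hsle hX0
        linarith
      have hwin' : ‖pairSumPath μ K ρ ϑ θ 0‖ * ((msD A₃ A₄ 1 *
            ((π / 2 * c₁ /
                  (((bandBounds (show (-4 : ℝ) < -1.1 by norm_num) (show (-1.1 : ℝ) ≤ -0.1 by norm_num) (show (-0.1 : ℝ) < 0 by norm_num)).Dtmin -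
                      2 * A) *
                    (bandBounds (show (-4 : ℝ) < -1.1 by norm_num) (show (-1.1 : ℝ) ≤ -0.1 by norm_num) (show (-0.1 : ℝ) < 0 by norm_num)).umin) +
                π * Kc * c₀ / ((bandBounds (show (-4 : ℝ) < -1.1 by norm_num) (show (-1.1 : ℝ) ≤ -0.1 by norm_num) (show (-0.1 : ℝ) < 0 by norm_num)).Dtmin - 2 * A) ^ 2) /
              ((bandBounds (show (-4 : ℝ) < -1.1 by norm_num) (show (-1.1 : ℝ) ≤ -0.1 by norm_num) (show (-0.1 : ℝ) < 0 by norm_num)).umin * w /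
                (4 + 2 * A)))) +
          c₀ / ((bandBounds (show (-4 : ℝ) < -1.1 by norm_num) (show (-1.1 : ℝ) ≤ -0.1 by norm_num) (show (-0.1 : ℝ) < 0 by norm_num)).Dtmin - 2 * A)) +
          2 * hi / ((bandBounds (show (-4 : ℝ) < -1.1 by norm_num) (show (-1.1 : ℝ) ≤ -0.1 by norm_num) (show (-0.1 : ℝ) < 0 by norm_num)).Dtmin - 2 * A) + ‖pairSumPath μ K ρ ϑ θ 0‖ <
        2 * (bandBounds (show (-4 : ℝ) < -1.1 by norm_num) (show (-1.1 : ℝ) ≤ -0.1 by norm_num) (show (-0.1 : ℝ) < 0 by norm_num)).umin := by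
        have h1 := mul_le_mul_of_nonneg_right hsle hX0
        linarith
      have hhir' : hi + c₀ * ‖pairSumPath μ K ρ ϑ θ 0‖ < r := by
        have h2 := mul_le_mul_of_nonneg_left hsle hc₀.le
        linarith
      have hCoop := level_loop_partnerBand_le_cooper_chord hA hA20 hd hlo hhi hA₃ hA₄ hK₂ hG hK₂0 (ϑ := ϑ) (θ := θ) (t := t) (wt := wt) hab hlo0 hlohi hhir₀ hhir'
        hc₀ hc₁ hs hX hwin hwin' hNC ht hW hw0 hw
      have hlog := posLog_chord_le_posLog_torusDist hA hr hlo hhi hρ (ϑ := ϑ) (θ := θ) (hi := hi) (by linarith) hc₀ hTpos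
      rw [hTd] at hlog
      have hPl := mul_le_mul_of_nonneg_left hlog hP0
      calc (∫ e in lo..hi, wt e * ∫ x in Icc a b, (max (t e) |frameLevel μ K (pairSumPath μ K ρ ϑ θ 0 - levelPoint μ K e (x + θ))|)⁻¹)
          ≤ W * (2 * (b - a) + 2 * (NC * c₀ / c₁) + (b - a) * log⁺ (hi / (c₀ * ‖pairSumPath μ K ρ ϑ θ 0‖ / 2))) := hCoop
        _ = (W * (2 * (b - a) + 2 * (NC * c₀ / c₁))) + (W * (b - a)) * log⁺ (hi / (c₀ * ‖pairSumPath μ K ρ ϑ θ 0‖ / 2)) := by ring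
        _ ≤ (W * ((4 * (b - a) / κ + 2 * (NT * (4 / d₁))) * (κ / 2) +
          2 * (12 * NT / Real.sqrt (w * (bandBounds (show (-4 : ℝ) < -1.1 by norm_num) (show (-1.1 : ℝ) ≤ -0.1 by norm_num) (show (-0.1 : ℝ) < 0 by norm_num)).umin ^ 2)) * Real.sqrt (κ / 2) + (b - a) * log⁺ (hi / (κ / 2)))) + (W * (2 * (b - a) + 2 * (NC * c₀ / c₁))) + (W * (b - a)) * log⁺ ((π * hi / (c₀ * (bandBounds (show (-4 : ℝ) < -1.1 by norm_num) (show (-1.1 : ℝ) ≤ -0.1 by norm_num) (show (-0.1 : ℝ) < 0 by norm_num)).umin)) / |ϑ - π|) := by linarith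
    · -- NON-COOPER CLASS (part 5): not Cooper relative to any sheet
      push Not at hsle
      have hC : ∀ m : Fin 2 → ℤ, ((msD A₃ A₄ 1 *
            ((π / 2 * d₁ /
                  (((bandBounds (show (-4 : ℝ) < -1.1 by norm_num) (show (-1.1 : ℝ) ≤ -0.1 by norm_num) (show (-0.1 : ℝ) < 0 by norm_num)).Dtmin -
                      2 * A) *
                    (bandBounds (show (-4 : ℝ) < -1.1 by norm_num) (show (-1.1 : ℝ) ≤ -0.1 by norm_num) (show (-0.1 : ℝ) < 0 by norm_num)).umin) +
                π * Kc * κ / ((bandBounds (show (-4 : ℝ) < -1.1 by norm_num) (show (-1.1 : ℝ) ≤ -0.1 by norm_num) (show (-0.1 : ℝ) < 0 by norm_num)).Dtmin - 2 * A) ^ 2) /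
              ((bandBounds (show (-4 : ℝ) < -1.1 by norm_num) (show (-1.1 : ℝ) ≤ -0.1 by norm_num) (show (-0.1 : ℝ) < 0 by norm_num)).umin * w /
                (4 + 2 * A)))) +
          κ / ((bandBounds (show (-4 : ℝ) < -1.1 by norm_num) (show (-1.1 : ℝ) ≤ -0.1 by norm_num) (show (-0.1 : ℝ) < 0 by norm_num)).Dtmin - 2 * A)) <
          ‖pairSumPath μ K ρ ϑ θ 0 - WithLp.toLp 2 (fun i => 2 * π * (m i : ℝ))‖ := by
        intro m
        by_cases hm : m = 0
        · have hv0 : (WithLp.toLp 2 (fun i => 2 * π * (m i : ℝ)) : Momentum) = 0 := by ext i; simp [hm]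
          rw [hv0, sub_zero]
          linarith
        · have h := norm_pairSum_sub_twoPi_gt hA hr hlo hhi hρ ϑ θ hm
          linarith
      have hT := level_loop_partnerBand_le_nonCooper hA hA20 hd hlo hhi hA₃ hA₄ hK₁ hK₂ hK₃ hG hK₁0 (ρ := ρ) (ϑ := ϑ) (θ := θ) (t := t) (wt := wt)
        hab hlo0 hlohi hhir₀ hhirT hκ hd₁ hC hsmall hNT hNT' ht hW hw0 hw
      have hlog0 := hposlog ((π * hi / (c₀ * (bandBounds (show (-4 : ℝ) < -1.1 by norm_num) (show (-1.1 : ℝ) ≤ -0.1 by norm_num) (show (-0.1 : ℝ) < 0 by norm_num)).umin)) / |ϑ - π|)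
      calc (∫ e in lo..hi, wt e * ∫ x in Icc a b, (max (t e) |frameLevel μ K (pairSumPath μ K ρ ϑ θ 0 - levelPoint μ K e (x + θ))|)⁻¹) ≤ (W * ((4 * (b - a) / κ + 2 * (NT * (4 / d₁))) * (κ / 2) +
          2 * (12 * NT / Real.sqrt (w * (bandBounds (show (-4 : ℝ) < -1.1 by norm_num) (show (-1.1 : ℝ) ≤ -0.1 by norm_num) (show (-0.1 : ℝ) < 0 by norm_num)).umin ^ 2)) * Real.sqrt (κ / 2) + (b - a) * log⁺ (hi / (κ / 2)))) := hT
        _ ≤ (W * ((4 * (b - a) / κ + 2 * (NT * (4 / d₁))) * (κ / 2) +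
          2 * (12 * NT / Real.sqrt (w * (bandBounds (show (-4 : ℝ) < -1.1 by norm_num) (show (-1.1 : ℝ) ≤ -0.1 by norm_num) (show (-0.1 : ℝ) < 0 by norm_num)).umin ^ 2)) * Real.sqrt (κ / 2) + (b - a) * log⁺ (hi / (κ / 2)))) + (W * (2 * (b - a) + 2 * (NC * c₀ / c₁))) + (W * (b - a)) * log⁺ ((π * hi / (c₀ * (bandBounds (show (-4 : ℝ) < -1.1 by norm_num) (show (-1.1 : ℝ) ≤ -0.1 by norm_num) (show (-0.1 : ℝ) < 0 by norm_num)).umin)) / |ϑ - π|) := by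
            have := mul_nonneg hP0 hlog0
            linarith

end Sizes

end Summit.HubbardSuperconductivity.HubbardSuperconductivity.Theorems.C4a

end
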